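import Summits.AtomisticToContinuum.Crystallization.Theses.PalmUnimodularRigidity
import Summits.AtomisticToContinuum.Crystallization.Theorems.ChargedEnergyGap.Negative.BlocksBound

/-!
# Route PalmUnimodularRigidity — item 0714 `CrysPeriodicBddBelow`

Item `stmt-AtomisticToContinuum-0714` (support, shared by the crystallization routes): the
Lennard-Jones energies per particle of periodic configurations of `ℝ³` (any full-rank lattice,
any finite motif) are bounded below, so that `⨅_Q e(Q)` is a genuine infimum (`ciInf_le`).

PROOF. This is exactly the tree theorem
`ChargedEnergyGapNegative.bddBelow_energyPerParticle_lennardJones`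
(`Theorems/ChargedEnergyGap/Negative/BlocksBound.lean`): every periodic `Q` satisfies
`e(Q) ≥ −2³²/12`, by cutting `Q` into the blocks `F + {∑ kᵢ bᵢ : 0 ≤ kᵢ < K}`, the exact identity
`2 E(block) = K³ · #F · 2e(Q) − (tails)`, finite Lennard-Jones stability for the block, and tails
`o(K³)` (summability of `r⁻⁶` in `d = 3` plus lattice-coordinate geometry).  The route decl is
closed by name.
-/

namespace Summit.AtomisticToContinuum.Crystallization.Theorems

/-- **Item 0714 `CrysPeriodicBddBelow`** (route `PalmUnimodularRigidity`, by name): the set of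
Lennard-Jones energies per particle `e(Q)` of periodic configurations `Q` of `ℝ³` is bounded
below.  One-line consequence of
`ChargedEnergyGapNegative.bddBelow_energyPerParticle_lennardJones` (lower bound `−2³²/12` from
finite stability through blocks). [folklore] -/
theorem crysPeriodicBddBelow_proof :
    Summit.AtomisticToContinuum.Crystallization.Theses.PalmUnimodularRigidity.CrysPeriodicBddBelow := by
  unfold Summit.AtomisticToContinuum.Crystallization.Theses.PalmUnimodularRigidity.CrysPeriodicBddBelow
  exact ChargedEnergyGapNegative.bddBelow_energyPerParticle_lennardJones

end Summit.AtomisticToContinuum.Crystallization.Theorems
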